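import Mathlib
import Summits.Ventures.LatticeQCDFlow.TrivializingMaps.HaarIntegrationByParts
import Summits.Ventures.LatticeQCDFlow.TrivializingMaps.JacobianTransport
import Summits.Ventures.LatticeQCDFlow.TrivializingMaps.JacobianTransportWeight
import Summits.Ventures.LatticeQCDFlow.TrivializingMaps.JacobianDensity

/-!
# LatticeQCDFlow / TrivializingMaps — the Jacobian formula with a `C¹` rate, up to the approximation error

HONEST FRAMING: exact (Metropolis-corrected) sampling algorithms for lattice gauge theory; figures
of merit are autocorrelation/cost numbers at stated couplings and volumes; no continuum-physics claim.

Venture `LatticeQCDFlow` (cell pub-lqcd), topic `TrivializingMaps`, row 31 (lean-2).  Penultimate step of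
the proof of Lüscher's eq. (3.9) (`JacobianFormula.lean`): for an ambient `C¹` observable `Õ`, a `C¹` rate
`c` with `|div Z_s - c(s, ·)| ≤ δ` on `[-T, T] × SU(n)^E` and the weighted transported observable `U` of
`JacobianTransportWeight`, the Haar integral `s ↦ ∫ D[U] U(s, U)` has derivative
`∫ D[U] (div Z_s - c) U(s, ·)` (`integral_fderiv_transportFnW_eq`: weighted transport identity + the
Liouville identity with source of `HaarIntegrationByParts`), hence (mean value inequality)
`|∫ D[V] Õ(Φ_t V) e^{∫₀ᵗ c(r, Φ_r V) dr} - ∫ D[U] Õ(U)| ≤ δ · sup|U| · |t|` — `jacobian_estimate`.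
Also: `C¹` functions are uniformly dense in `C(K, ℝ)` for compact `K` in a real normed space
(`exists_contDiff_one_approx_on`, Stone–Weierstrass with the separating dual), a speed bound for the
cut-off flow, and differentiation under the Haar integral for jointly `C¹` integrands.

All elementary ([folklore]).
-/

noncomputable section

open MeasureTheory Matrix Set Filter Function Metric intervalIntegral
open scoped Matrix Topology NNReal

namespace Summit.Ventures.LatticeQCDFlow.TrivializingMaps

open Literature.MathematicalPhysics.QuantumFieldTheory
open Literature.MathematicalPhysics.QuantumFieldTheory.Luscher2010
open Literature.MathematicalPhysics.QuantumFieldTheory.WilsonFlow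
open Literature.Analysis.ODE
open scoped Matrix.Norms.Frobenius ContDiff

variable {d L n : ℕ}

/-! ## §1. Two analytic lemmas -/

section Lemmas

/-- **`C¹` functions are uniformly dense in the continuous functions on a compact subset of a real normed
space** (Stone–Weierstrass; continuous linear functionals separate points). [folklore] -/
theorem exists_contDiff_one_approx_on {E : Type*} [NormedAddCommGroup E] [NormedSpace ℝ E]
    {K : Set E} (hK : IsCompact K) {f : E → ℝ} (hf : Continuous f) {ε : ℝ} (hε : 0 < ε) :
    ∃ c : E → ℝ, ContDiff ℝ 1 c ∧ ∀ x ∈ K, |f x - c x| < ε := by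
  haveI : CompactSpace K := isCompact_iff_compactSpace.1 hK
  let A : Subalgebra ℝ C(K, ℝ) :=
    { carrier := {g | ∃ c : E → ℝ, ContDiff ℝ 1 c ∧ ∀ x : K, g x = c x}
      mul_mem' := by
        rintro g g' ⟨c, hc, hg⟩ ⟨c', hc', hg'⟩
        exact ⟨fun x => c x * c' x, hc.mul hc', fun x => by simp [hg x, hg' x]⟩
      one_mem' := ⟨fun _ => 1, contDiff_const, fun x => by simp⟩
      add_mem' := by
        rintro g g' ⟨c, hc, hg⟩ ⟨c', hc', hg'⟩
        exact ⟨fun x => c x + c' x, hc.add hc', fun x => by simp [hg x, hg' x]⟩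
      zero_mem' := ⟨fun _ => 0, contDiff_const, fun x => by simp⟩
      algebraMap_mem' := fun r => ⟨fun _ => r, contDiff_const, fun x => by simp⟩ }
  have hA : A.SeparatesPoints := by
    intro x y hxy
    have hxy' : (x : E) ≠ y := fun h => hxy (Subtype.ext h)
    obtain ⟨φ, hφ⟩ := SeparatingDual.exists_separating_of_ne (R := ℝ) hxy'
    exact ⟨_, ⟨⟨fun z : K => φ z, φ.continuous.comp continuous_subtype_val⟩,
      ⟨fun z => φ z, φ.contDiff, fun z => rfl⟩, rfl⟩, hφ⟩
  have hdense := ContinuousMap.subalgebra_topologicalClosure_eq_top_of_separatesPoints A hA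
  set fK : C(K, ℝ) := ⟨fun x : K => f x, hf.comp continuous_subtype_val⟩ with hfK
  have hmem : fK ∈ A.topologicalClosure := by rw [hdense]; trivial
  have hmem' : fK ∈ closure (A : Set C(K, ℝ)) := by
    rw [← Subalgebra.topologicalClosure_coe, SetLike.mem_coe]; exact hmem
  obtain ⟨g, ⟨c, hc, hg⟩, hdist⟩ := Metric.mem_closure_iff.1 hmem' ε hε
  refine ⟨c, hc, fun x hx => ?_⟩
  have h1 := ContinuousMap.dist_apply_le_dist (f := fK) (g := g) ⟨x, hx⟩
  rw [hg ⟨x, hx⟩] at h1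
  rw [← Real.dist_eq]
  exact lt_of_le_of_lt h1 hdist

/-- `exp` is `e^A`-Lipschitz on `(-∞, A]`. [folklore] -/
theorem abs_exp_sub_exp_le {x y A : ℝ} (hx : x ≤ A) (hy : y ≤ A) :
    |Real.exp x - Real.exp y| ≤ Real.exp A * |x - y| := by
  have h := (convex_Iic A).norm_image_sub_le_of_norm_hasDerivWithin_le
    (f := Real.exp) (f' := Real.exp) (fun z _ => (Real.hasDerivAt_exp z).hasDerivWithinAt)
    (fun z hz => by rw [Real.norm_eq_abs, abs_of_pos (Real.exp_pos z)]; exact Real.exp_le_exp.2 hz)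
    hy hx
  simpa only [Real.norm_eq_abs] using h

end Lemmas

/-! ## §2. Trajectory bounds for the cut-off flow and the `s`-derivative under the Haar integral -/

section Flow

variable [NeZero L] {Z : Generator d L n} (hZ1 : ContDiff ℝ 1 fun p : ℝ × AmbConfig d L n => Z p.1 p.2)
  (T : ℝ)

/-- **Speed bound**: the cut-off flow moves at most linearly in time: `‖Ψ_{s→r} W - W‖ ≤ S |r - s|`. [folklore] -/
theorem exists_speed_bound : ∃ S : ℝ, 0 ≤ S ∧ ∀ s r (W : AmbConfig d L n),
    ‖cutFlow hZ1 T s r W - W‖ ≤ S * |r - s| := by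
  obtain ⟨S, hS⟩ := (contDiff_cutField hZ1 T).continuous.bounded_above_of_compact_support
    (hasCompactSupport_cutField Z T)
  refine ⟨max S 0, le_max_right S 0, fun s r W => ?_⟩
  have h := (convex_univ (𝕜 := ℝ) (E := ℝ)).norm_image_sub_le_of_norm_hasDerivWithin_le
    (f := fun r => cutFlow hZ1 T s r W) (f' := fun r => cutField Z T (r, cutFlow hZ1 T s r W))
    (C := max S 0) (fun r _ => (hasDerivAt_cutFlow hZ1 T s W r).hasDerivWithinAt)
    (fun r _ => (hS _).trans (le_max_left S 0)) (mem_univ s) (mem_univ r)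
  rw [cutFlow_self] at h
  simpa only [Real.norm_eq_abs] using h

/-- **Differentiation under the Haar integral** for a jointly `C¹` function read on `ℝ × SU(n)^E`:
`s ↦ ∫ D[U] G(s, U)` has derivative `∫ D[U] DG(s, U)[(1, 0)]`. [folklore] -/
theorem hasDerivAt_integral_coeConfig {G : ℝ × AmbConfig d L n → ℝ} (hG : ContDiff ℝ 1 G) (s : ℝ) :
    HasDerivAt (fun σ => ∫ V, G (σ, coeConfig V) ∂(trivialMeasure (Matrix.specialUnitaryGroup (Fin n) ℂ) d L))
      (∫ V, fderiv ℝ G (s, coeConfig V) ((1 : ℝ), (0 : AmbConfig d L n))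
        ∂(trivialMeasure (Matrix.specialUnitaryGroup (Fin n) ℂ) d L)) s := by
  haveI : SecondCountableTopology (Matrix (Fin n) (Fin n) ℂ) :=
    inferInstanceAs (SecondCountableTopology (Fin n → Fin n → ℂ))
  haveI : SecondCountableTopology (Matrix.specialUnitaryGroup (Fin n) ℂ) :=
    Topology.IsEmbedding.subtypeVal.secondCountableTopology
  haveI : IsProbabilityMeasure (trivialMeasure (Matrix.specialUnitaryGroup (Fin n) ℂ) d L) := by
    unfold trivialMeasure; infer_instance
  let F : ℝ → GaugeConfig d L (Matrix.specialUnitaryGroup (Fin n) ℂ) → ℝ := fun σ V => G (σ, coeConfig V)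
  let F' : ℝ → GaugeConfig d L (Matrix.specialUnitaryGroup (Fin n) ℂ) → ℝ := fun σ V =>
    fderiv ℝ G (σ, coeConfig V) ((1 : ℝ), (0 : AmbConfig d L n))
  have hderiv : ∀ V σ, HasDerivAt (fun σ => F σ V) (F' σ V) σ := by
    intro V σ
    have h1 : HasDerivAt (fun σ : ℝ => ((σ, coeConfig V) : ℝ × AmbConfig d L n))
        ((1 : ℝ), (0 : AmbConfig d L n)) σ := (hasDerivAt_id σ).prodMk (hasDerivAt_const σ _)
    exact (hG.differentiable one_ne_zero _).hasFDerivAt.comp_hasDerivAt σ h1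
  have hinc : Continuous fun p : ℝ × GaugeConfig d L (Matrix.specialUnitaryGroup (Fin n) ℂ) =>
      ((p.1, coeConfig p.2) : ℝ × AmbConfig d L n) :=
    continuous_fst.prodMk (continuous_coeConfig.comp continuous_snd)
  have hFu : Continuous fun p : ℝ × GaugeConfig d L (Matrix.specialUnitaryGroup (Fin n) ℂ) => F p.1 p.2 :=
    hG.continuous.comp hinc
  have hF'u : Continuous fun p : ℝ × GaugeConfig d L (Matrix.specialUnitaryGroup (Fin n) ℂ) => F' p.1 p.2 :=
    ((hG.continuous_fderiv one_ne_zero).comp hinc).clm_apply continuous_const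
  have hF_cont : ∀ σ, Continuous (F σ) := fun σ => hFu.uncurry_left σ
  have hF'_cont : ∀ σ, Continuous (F' σ) := fun σ => hF'u.uncurry_left σ
  obtain ⟨C, hC⟩ : ∃ C, ∀ p ∈ (closedBall s 1) ×ˢ
      (univ : Set (GaugeConfig d L (Matrix.specialUnitaryGroup (Fin n) ℂ))), ‖F' p.1 p.2‖ ≤ C :=
    ((isCompact_closedBall s 1).prod isCompact_univ).exists_bound_of_continuousOn hF'u.continuousOn
  have hmain := hasDerivAt_integral_of_dominated_loc_of_deriv_le
    (μ := trivialMeasure (Matrix.specialUnitaryGroup (Fin n) ℂ) d L) (F := F) (F' := F')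
    (x₀ := s) (s := ball s 1) (bound := fun _ => C) (ball_mem_nhds s one_pos)
    (Eventually.of_forall fun σ => (hF_cont σ).aestronglyMeasurable)
    ((BoundedContinuousFunction.mkOfCompact ⟨F s, hF_cont s⟩).integrable _)
    (hF'_cont s).aestronglyMeasurable
    (ae_of_all _ fun V σ hσ => hC (σ, V) ⟨ball_subset_closedBall hσ, mem_univ _⟩)
    (integrable_const C) (ae_of_all _ fun V σ _ => hderiv V σ)
  exact hmain.2

end Flow

/-! ## §3. The formula with a `C¹` rate, up to the approximation error -/

section Estimate

variable [NeZero L] (B : SuBasis n) {Z : Generator d L n}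
  (hZ1 : ContDiff ℝ 1 fun p : ℝ × AmbConfig d L n => Z p.1 p.2) (T t : ℝ)
  {c : ℝ × AmbConfig d L n → ℝ} {O : AmbConfig d L n → ℝ}

/-- **The `s`-derivative of the weighted transported observable, integrated against `D[U]`, is the defect
`∫ D[U] (div Z_s - c) U(s, ·)`** for `|s| ≤ T` (weighted transport identity + Liouville identity with
source). [cite: Luscher2010Trivializing, §3.2 eq. (3.9)] -/
theorem integral_fderiv_transportFnW_eq (hZt : Z.IsTangent) (hc : ContDiff ℝ 1 c) (hO : ContDiff ℝ 1 O)
    {s : ℝ} (hs : |s| ≤ T) :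
    ∫ V, fderiv ℝ (transportFnW hZ1 T c t O) (s, coeConfig V) ((1 : ℝ), (0 : AmbConfig d L n))
        ∂(trivialMeasure (Matrix.specialUnitaryGroup (Fin n) ℂ) d L) =
      ∫ V, (linkDiv B (Z s) (coeConfig V) - c (s, coeConfig V)) * transportFnW hZ1 T c t O (s, coeConfig V)
        ∂(trivialMeasure (Matrix.specialUnitaryGroup (Fin n) ℂ) d L) := by
  haveI : SecondCountableTopology (Matrix (Fin n) (Fin n) ℂ) :=
    inferInstanceAs (SecondCountableTopology (Fin n → Fin n → ℂ))
  haveI : SecondCountableTopology (Matrix.specialUnitaryGroup (Fin n) ℂ) :=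
    Topology.IsEmbedding.subtypeVal.secondCountableTopology
  haveI : IsProbabilityMeasure (trivialMeasure (Matrix.specialUnitaryGroup (Fin n) ℂ) d L) := by
    unfold trivialMeasure; infer_instance
  set Uf := transportFnW hZ1 T c t O with hUf
  have hUc : ContDiff ℝ 1 Uf := contDiff_transportFnW hZ1 T c t hc hO
  set ψ : AmbConfig d L n → ℝ := fun W => Uf (s, W) with hψ
  have hψc : ContDiff ℝ 1 ψ := hUc.comp (contDiff_const.prodMk contDiff_id)
  have hψd : ∀ W (v : AmbConfig d L n), fderiv ℝ ψ W v = fderiv ℝ Uf (s, W) ((0 : ℝ), v) := by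
    intro W v
    have h1 : HasFDerivAt (fun W : AmbConfig d L n => ((s, W) : ℝ × AmbConfig d L n))
        (ContinuousLinearMap.inr ℝ ℝ (AmbConfig d L n)) W := hasFDerivAt_prodMk_right s W
    have h3 : HasFDerivAt ψ ((fderiv ℝ Uf (s, W)).comp (ContinuousLinearMap.inr ℝ ℝ (AmbConfig d L n))) W :=
      (hUc.differentiable one_ne_zero _).hasFDerivAt.comp W h1
    rw [h3.fderiv, ContinuousLinearMap.comp_apply, ContinuousLinearMap.inr_apply]
  have hpt : ∀ V : GaugeConfig d L (Matrix.specialUnitaryGroup (Fin n) ℂ),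
      fderiv ℝ Uf (s, coeConfig V) ((1 : ℝ), (0 : AmbConfig d L n)) =
        -(fderiv ℝ ψ (coeConfig V) (fun e => Z s (coeConfig V) e * coeConfig V e)
          + linkDiv B (Z s) (coeConfig V) * ψ (coeConfig V))
        + (linkDiv B (Z s) (coeConfig V) - c (s, coeConfig V)) * Uf (s, coeConfig V) := by
    intro V
    have hti := fderiv_transportFnW_apply_one_cutField hZ1 T c t hc hO s (coeConfig V)
    rw [cutField_eq_of_abs_le Z hs V] at hti
    have hsplit : (((1 : ℝ), fun e => Z s (coeConfig V) e * coeConfig V e) : ℝ × AmbConfig d L n) =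
        ((1 : ℝ), (0 : AmbConfig d L n)) + ((0 : ℝ), fun e => Z s (coeConfig V) e * coeConfig V e) := by
      simp
    rw [hsplit, map_add] at hti
    rw [← hUf] at hti
    rw [hψd]
    show _ = -(_ + linkDiv B (Z s) (coeConfig V) * Uf (s, coeConfig V)) + _
    linarith
  simp_rw [hpt]
  have hcontU : Continuous fun V : GaugeConfig d L (Matrix.specialUnitaryGroup (Fin n) ℂ) =>
      Uf (s, coeConfig V) := hUc.continuous.comp (continuous_const.prodMk continuous_coeConfig)
  have hint2 : Integrable (fun V : GaugeConfig d L (Matrix.specialUnitaryGroup (Fin n) ℂ) =>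
      (linkDiv B (Z s) (coeConfig V) - c (s, coeConfig V)) * Uf (s, coeConfig V))
      (trivialMeasure (Matrix.specialUnitaryGroup (Fin n) ℂ) d L) := by
    refine (BoundedContinuousFunction.mkOfCompact ⟨_, ?_⟩).integrable _
    refine (Continuous.sub ?_ (hc.continuous.comp (continuous_const.prodMk continuous_coeConfig))).mul hcontU
    exact (continuous_linkDiv_param B hZ1).comp₂ continuous_const continuous_coeConfig
  have hint1 : Integrable (fun V : GaugeConfig d L (Matrix.specialUnitaryGroup (Fin n) ℂ) =>
      -(fderiv ℝ ψ (coeConfig V) (fun e => Z s (coeConfig V) e * coeConfig V e)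
        + linkDiv B (Z s) (coeConfig V) * ψ (coeConfig V)))
      (trivialMeasure (Matrix.specialUnitaryGroup (Fin n) ℂ) d L) := by
    refine (BoundedContinuousFunction.mkOfCompact ⟨_, ?_⟩).integrable _
    refine Continuous.neg (Continuous.add ?_ ?_)
    · have h1 : Continuous fun V : GaugeConfig d L (Matrix.specialUnitaryGroup (Fin n) ℂ) =>
          fderiv ℝ ψ (coeConfig V) := (hψc.continuous_fderiv one_ne_zero).comp continuous_coeConfig
      have h2 : Continuous fun V : GaugeConfig d L (Matrix.specialUnitaryGroup (Fin n) ℂ) =>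
          (fun e => Z s (coeConfig V) e * coeConfig V e : AmbConfig d L n) := by
        refine continuous_pi fun e => ?_
        exact ((continuous_apply e).comp ((hZ1.continuous.comp
          (continuous_const.prodMk continuous_coeConfig)))).mul
          ((continuous_apply e).comp continuous_coeConfig)
      exact h1.clm_apply h2
    · exact ((continuous_linkDiv_param B hZ1).comp₂ continuous_const continuous_coeConfig).mul
        (hψc.continuous.comp continuous_coeConfig)
  have hZs : ContDiff ℝ 1 (Z s) := hZ1.comp (contDiff_const.prodMk contDiff_id)
  rw [integral_add hint1 hint2, MeasureTheory.integral_neg,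
    integral_fderiv_add_linkDiv_mul_eq_zero B hψc (Y := Z s) hZs (fun U e => hZt s U e), neg_zero, zero_add]

/-- **The Jacobian formula with a `C¹` rate `c`, up to the approximation error**: if `|div Z_s - c(s, ·)| ≤ δ`
on `[-T, T] × SU(n)^E` (`T = |t| + 1`) and the weighted transported observable is bounded by `M` there, then
`|∫ D[V] Õ(Φ_t V) e^{∫₀ᵗ c(r, Φ_r V) dr} - ∫ D[U] Õ(U)| ≤ δ M |t|` (mean value inequality for
`s ↦ ∫ D[U] U(s, U)` on `[-T, T]`). [cite: Luscher2010Trivializing, §3.2 eq. (3.9)] -/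
theorem jacobian_estimate (hZt : Z.IsTangent) {Φ : ℝ → GaugeConfig d L (Matrix.specialUnitaryGroup (Fin n) ℂ) →
      GaugeConfig d L (Matrix.specialUnitaryGroup (Fin n) ℂ)} (hΦ : IsFlowMap Z Φ) (hT : T = |t| + 1)
    (hc : ContDiff ℝ 1 c) (hO : ContDiff ℝ 1 O) {δ M : ℝ}
    (hδ : ∀ (s : ℝ) (V : GaugeConfig d L (Matrix.specialUnitaryGroup (Fin n) ℂ)), |s| ≤ T →
      |linkDiv B (Z s) (coeConfig V) - c (s, coeConfig V)| ≤ δ)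
    (hM : ∀ (s : ℝ) (V : GaugeConfig d L (Matrix.specialUnitaryGroup (Fin n) ℂ)), |s| ≤ T →
      |transportFnW hZ1 T c t O (s, coeConfig V)| ≤ M) :
    |(∫ V, O (coeConfig (Φ t V)) * Real.exp (∫ r in (0 : ℝ)..t, c (r, coeConfig (Φ r V)))
        ∂(trivialMeasure (Matrix.specialUnitaryGroup (Fin n) ℂ) d L)) -
      ∫ U, O (coeConfig U) ∂(trivialMeasure (Matrix.specialUnitaryGroup (Fin n) ℂ) d L)| ≤ δ * M * |t| := by
  haveI : SecondCountableTopology (Matrix (Fin n) (Fin n) ℂ) :=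
    inferInstanceAs (SecondCountableTopology (Fin n → Fin n → ℂ))
  haveI : SecondCountableTopology (Matrix.specialUnitaryGroup (Fin n) ℂ) :=
    Topology.IsEmbedding.subtypeVal.secondCountableTopology
  haveI : IsProbabilityMeasure (trivialMeasure (Matrix.specialUnitaryGroup (Fin n) ℂ) d L) := by
    unfold trivialMeasure; infer_instance
  have hT0 : 0 < T := by rw [hT]; positivity
  have ht : t ∈ Ioo (-T) T := by rw [hT]; constructor <;> cases abs_cases t <;> linarith
  have h0 : (0 : ℝ) ∈ Ioo (-T) T := ⟨by linarith, hT0⟩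
  set Uf := transportFnW hZ1 T c t O with hUf
  have hUc : ContDiff ℝ 1 Uf := contDiff_transportFnW hZ1 T c t hc hO
  set g : ℝ → ℝ := fun σ => ∫ V, Uf (σ, coeConfig V)
    ∂(trivialMeasure (Matrix.specialUnitaryGroup (Fin n) ℂ) d L) with hg
  -- derivative of `g` and its bound on `[-T, T]`
  have hgd : ∀ σ, HasDerivAt g (∫ V, fderiv ℝ Uf (σ, coeConfig V) ((1 : ℝ), (0 : AmbConfig d L n))
      ∂(trivialMeasure (Matrix.specialUnitaryGroup (Fin n) ℂ) d L)) σ :=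
    fun σ => hasDerivAt_integral_coeConfig hUc σ
  have hbound : ∀ σ ∈ Icc (-T) T, ‖∫ V, fderiv ℝ Uf (σ, coeConfig V) ((1 : ℝ), (0 : AmbConfig d L n))
      ∂(trivialMeasure (Matrix.specialUnitaryGroup (Fin n) ℂ) d L)‖ ≤ δ * M := by
    intro σ hσ
    have hσ' : |σ| ≤ T := abs_le.2 ⟨hσ.1, hσ.2⟩
    rw [hUf, integral_fderiv_transportFnW_eq B hZ1 T t hZt hc hO hσ', ← hUf]
    have := norm_integral_le_of_norm_le_const
      (μ := trivialMeasure (Matrix.specialUnitaryGroup (Fin n) ℂ) d L)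
      (f := fun V => (linkDiv B (Z σ) (coeConfig V) - c (σ, coeConfig V)) * Uf (σ, coeConfig V))
      (C := δ * M) (ae_of_all _ fun V => ?_)
    · rwa [probReal_univ, mul_one] at this
    · rw [norm_mul, Real.norm_eq_abs, Real.norm_eq_abs]
      exact mul_le_mul (hδ σ V hσ') (hM σ V hσ') (abs_nonneg _) ((abs_nonneg _).trans (hδ σ V hσ'))
  -- mean value inequality between `0` and `t`
  have hmv := (convex_Icc (-T) T).norm_image_sub_le_of_norm_hasDerivWithin_le
    (fun σ _ => (hgd σ).hasDerivWithinAt) hbound (Ioo_subset_Icc_self ht) (Ioo_subset_Icc_self h0)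
  -- identify `g t` and `g 0`
  have hgt : g t = ∫ U, O (coeConfig U) ∂(trivialMeasure (Matrix.specialUnitaryGroup (Fin n) ℂ) d L) := by
    simp only [hg, hUf, transportFnW_self]
  have hflow : ∀ V (r : ℝ), r ∈ Ioo (-T) T → cutFlow hZ1 T 0 r (coeConfig V) = coeConfig (Φ r V) :=
    fun V r hr => cutFlow_eq_coeConfig hZ1 T hΦ hT0 V hr
  have hg0 : g 0 = ∫ V, O (coeConfig (Φ t V)) * Real.exp (∫ r in (0 : ℝ)..t, c (r, coeConfig (Φ r V)))
      ∂(trivialMeasure (Matrix.specialUnitaryGroup (Fin n) ℂ) d L) := by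
    simp only [hg, hUf, transportFnW, logJacW]
    refine integral_congr_ae (ae_of_all _ fun V => ?_)
    beta_reduce
    rw [hflow V t ht]
    congr 2
    refine intervalIntegral.integral_congr fun r hr => ?_
    have hr' : r ∈ Ioo (-T) T := by
      rcases mem_uIcc.1 hr with h | h
      · exact ⟨lt_of_lt_of_le h0.1 h.1, lt_of_le_of_lt h.2 ht.2⟩
      · exact ⟨lt_of_lt_of_le ht.1 h.1, lt_of_le_of_lt h.2 h0.2⟩
    show c (r, cutFlow hZ1 T 0 r (coeConfig V)) = c (r, coeConfig (Φ r V))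
    rw [hflow V r hr']
  rw [← hg0, ← hgt]
  calc |g 0 - g t| = ‖g 0 - g t‖ := (Real.norm_eq_abs _).symm
    _ ≤ δ * M * ‖(0 : ℝ) - t‖ := hmv
    _ = δ * M * |t| := by rw [Real.norm_eq_abs, zero_sub, abs_neg]

end Estimate

end Summit.Ventures.LatticeQCDFlow.TrivializingMaps

end
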